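import Summits.CriticalPhenomena.SAWScalingLimit.Theses.SAWLoopFugacityFlow
import Summits.CriticalPhenomena.SAWScalingLimit.Theorems.IsingBoundaryRatio.Negative.IsingBoundaryRatioNesting
import Summits.CriticalPhenomena.SAWScalingLimit.Theorems.SAWLoopFugacityFlowIsingBoundaryRatioAnchorTransfer
import Summits.CriticalPhenomena.SAWScalingLimit.Theorems.SAWLoopFugacityFlowIsingBoundaryRatioForgettingDefs
import Summits.CriticalPhenomena.SAWScalingLimit.Theorems.SAWLoopFugacityFlowIsingBoundaryRatioChartAnnulusSeparation
import Summits.CriticalPhenomena.SAWScalingLimit.Theorems.SAWLoopFugacityFlowIsingBoundaryRatioReverseDobrushin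
import Summits.CriticalPhenomena.SAWScalingLimit.Theorems.SAWLoopFugacityFlowIsingBoundaryRatioEdwardsSokalFinset
import Summits.CriticalPhenomena.SAWScalingLimit.Theorems.SAWLoopFugacityFlowIsingBoundaryRatioLocalAgreementTransfer
import Summits.CriticalPhenomena.SAWScalingLimit.Theorems.SAWLoopFugacityFlowIsingBoundaryRatioRoughHalfAnnulusRSWLarge
import Summits.CriticalPhenomena.SAWScalingLimit.Theorems.SAWLoopFugacityFlowIsingBoundaryRatioChartDiscOneComponent
import Summits.CriticalPhenomena.SAWScalingLimit.Theorems.SAWLoopFugacityFlowIsingBoundaryRatioWindowExtResistanceBound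
import Summits.CriticalPhenomena.SAWScalingLimit.Theorems.SAWLoopFugacityFlowIsingBoundaryRatioHalfAnnulusSideCrossingBoundOf
import Summits.CriticalPhenomena.SAWScalingLimit.Theorems.SAWLoopFugacityFlowIsingBoundaryRatioAnnCrossThroughWindowRect
import Summits.CriticalPhenomena.SAWScalingLimit.Theorems.SAWLoopFugacityFlowIsingBoundaryRatioHalfAnnulusRimCrossingBoundLargeOf
import Summits.CriticalPhenomena.SAWScalingLimit.Theorems.SAWLoopFugacityFlowIsingBoundaryRatioRadialCrossingBound
import Summits.CriticalPhenomena.SAWScalingLimit.Theorems.SAWLoopFugacityFlowIsingBoundaryRatioFkArmOriginForgettingBS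
import Summits.CriticalPhenomena.SAWScalingLimit.Theorems.SAWLoopFugacityFlowIsingBoundaryRatioWindowRectPresentation
import Literature.Probability.LatticeModels.DiscreteExtremalLengthExternalArcsProofs
import Literature.Probability.LatticeModels.DiscreteExtremalLengthExternalArcsSelfDual
import Literature.Probability.LatticeModels.PlanarIsingOnePointProofs
import HarnessLib

/-!
# Crux `IsingBoundaryRatio` (stmt-CriticalPhenomena-10650), line `fk-anchor-transfer`: the glue

The line skeleton (`Cruxes/IsingBoundaryRatio/Lines/fk_anchor_transfer.lean`, rev 15) proves the crux
`Theses.SAWLoopFugacityFlow.IsingBoundaryRatio` from two printed named facts — CDH16 Thm 1.1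
(`fkIsing_topologicalRectangle_crossingBounds`, crossing bounds for critical FK–Ising in discrete topological
rectangles) and CHI15 Thm 1.1 with free boundary conditions (`chi_twoPoint_free_jordan`) — through landed
theorems of `Theorems.IsingBoundaryRatio` and some in-file glue. This module re-lands that glue over tree
declarations only (no definitions; the two named facts are explicit hypotheses):

* `T_comm`, `transfer_algebra`, `eventually_bulk_reachable` — lattice and real-arithmetic helpers;
* `anchorTransfer_of_anchorLocality` — anchor locality at the two marked prime ends ⇒ anchor transfer
  (difference form), by the GKS sandwich `T_mono`, positivity `T_pos_of_reachable` and symmetry of `T`;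
* `roughHalfAnnulusRSWMeshLarge_of_cdh16`, `fkArmOriginForgettingAt_of_cdh16`,
  `armOriginForgettingAt'_of_cdh16`, `armOriginForgetting'_of_core`, `anchorLocality_of_cdh16` — CDH16 Thm 1.1 ⇒
  mesh RSW ⇒ the FK heart (`stub_fkArmOriginForgettingBS`) ⇒ the repaired arm-origin forgetting (Edwards–Sokal,
  `stub_freeTwoPoint_eq_fkConn`) ⇒ anchor locality (`stub_localAgreementTransfer'`, `stub_reverseDobrushin`);
* `IsingBoundaryRatio_of` — the two named facts ⇒ the crux, through `isingBoundaryRatio_iff_anchorTransfer`.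

`T Ω δ x y` is `Negative.T`, the landed normal form of the crux's inline free critical two-point function.
-/

noncomputable section

open scoped Classical Topology
open MeasureTheory Filter Set Function Metric
open Literature.Probability.LatticeModels Literature.Probability.RandomPlanarGeometry
open UpperHalfPlane (upperHalfPlaneSet)

namespace Summit.CriticalPhenomena.SAWScalingLimit.Theorems.IsingBoundaryRatio.CruxGlue

open Summit.CriticalPhenomena.SAWScalingLimit.Theorems.IsingBoundaryRatio.Negative

/-! ### Lattice and algebra helpers -/

/-- Symmetry `⟨σ_xσ_y⟩ = ⟨σ_yσ_x⟩` of the crux's free critical two-point function `T`. [folklore] -/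
theorem T_comm : ∀ (Ω : Set ℂ) (δ : ℝ) (x y : Site 2), T Ω δ x y = T Ω δ y x := by
  intro Ω δ x y
  unfold T isingTwoPoint spinPair
  congr 1
  funext σ
  ring

/-- Pure real-arithmetic core of the two-end transfer: two double ratios within `η₁ ≤ 1` of `1`
and the bound `W' ≤ W` give `|A'/A − W'/W| < η` once `3η₁ ≤ η`. [folklore] -/
theorem transfer_algebra {A' A Z' Z W' W η₁ η : ℝ} (hA : 0 < A) (hZ' : 0 < Z') (hZ : 0 < Z)
    (hW' : 0 < W') (hW : 0 < W) (hWW : W' ≤ W) (hη₁ : η₁ ≤ 1) (hη : 3 * η₁ ≤ η)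
    (h₁ : |A' / Z' / (A / Z) - 1| < η₁) (h₂ : |Z' / W' / (Z / W) - 1| < η₁) :
    |A' / A - W' / W| < η := by
  have hA0 : A ≠ 0 := hA.ne'
  have hZ'0 : Z' ≠ 0 := hZ'.ne'
  have hZ0 : Z ≠ 0 := hZ.ne'
  have hW'0 : W' ≠ 0 := hW'.ne'
  have hW0 : W ≠ 0 := hW.ne'
  set X := A' / Z' / (A / Z) with hX
  set Y := Z' / W' / (Z / W) with hY
  have key : A' / A = X * Y * (W' / W) := by
    simp only [hX, hY]
    field_simp
  have hB0 : 0 < W' / W := div_pos hW' hW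
  have hB1 : W' / W ≤ 1 := (div_le_one hW).2 hWW
  have hYb : |Y| ≤ 1 + η₁ := by
    calc |Y| = |(Y - 1) + 1| := by rw [sub_add_cancel]
      _ ≤ |Y - 1| + |(1 : ℝ)| := abs_add_le _ _
      _ ≤ 1 + η₁ := by rw [abs_one]; linarith [h₂.le]
  have hXY : |X * Y - 1| < 3 * η₁ := by
    have e : X * Y - 1 = (X - 1) * Y + (Y - 1) := by ring
    rw [e]
    have h3 : |(X - 1) * Y| ≤ |X - 1| * (1 + η₁) := by
      rw [abs_mul]
      exact mul_le_mul_of_nonneg_left hYb (abs_nonneg _)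
    have h4 : |X - 1| * (1 + η₁) < η₁ * (1 + η₁) :=
      mul_lt_mul_of_pos_right h₁ (by linarith [abs_nonneg (X - 1)])
    have h5 : η₁ * (1 + η₁) ≤ 2 * η₁ := by nlinarith [abs_nonneg (X - 1)]
    calc |(X - 1) * Y + (Y - 1)| ≤ |(X - 1) * Y| + |Y - 1| := abs_add_le _ _
      _ < 3 * η₁ := by linarith
  calc |A' / A - W' / W| = |W' / W| * |X * Y - 1| := by
        rw [key, ← abs_mul]
        congr 1
        ring
    _ ≤ 1 * |X * Y - 1| := by
        gcongr
        rw [abs_of_pos hB0]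
        exact hB1
    _ < η := by linarith

/-- Interior points `z, w` of a Dobrushin domain `D'`: their rounded sites are eventually joined in `Ω'_δ`
to the endpoint approximation `b δ` and to each other (the largest mesh component of a Jordan domain
eventually contains every compact subset, `JordanDomain.eventually_forall_mem_meshDomain'`). [folklore] -/
theorem eventually_bulk_reachable {D' : DobrushinDomain} {a b : ℝ → Site 2}
    (hD' : SAW.IsEndpointApprox D' a b) {z w : ℂ} (hz : z ∈ D'.carrier) (hw : w ∈ D'.carrier) :
    ∀ᶠ δ in 𝓝[>] (0 : ℝ),
      (discreteDomainGraph D'.carrier δ).Reachable (nearestSite δ z) (b δ) ∧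
      (discreteDomainGraph D'.carrier δ).Reachable (nearestSite δ z) (nearestSite δ w) := by
  obtain ⟨ρz, hρz, hballz⟩ := Metric.isOpen_iff.1 D'.isOpen z hz
  obtain ⟨ρw, hρw, hballw⟩ := Metric.isOpen_iff.1 D'.isOpen w hw
  have hK : IsCompact (closedBall z (ρz / 2) ∪ closedBall w (ρw / 2)) :=
    (isCompact_closedBall _ _).union (isCompact_closedBall _ _)
  have hKD' : closedBall z (ρz / 2) ∪ closedBall w (ρw / 2) ⊆ D'.carrier :=
    union_subset ((closedBall_subset_ball (by linarith)).trans hballz)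
      ((closedBall_subset_ball (by linarith)).trans hballw)
  filter_upwards [hD'.reachable, eventually_ne hD',
    D'.toJordanDomain.eventually_forall_mem_meshDomain' hK hKD',
    Ioo_mem_nhdsGT (lt_min (half_pos hρz) (half_pos hρw))] with δ hr hne hJ hδ
  have hzK : meshPoint δ (nearestSite δ z) ∈ closedBall z (ρz / 2) ∪ closedBall w (ρw / 2) :=
    Or.inl (mem_closedBall.2 ((dist_meshPoint_nearestSite_le hδ.1 z).trans
      (hδ.2.le.trans (min_le_left _ _))))
  have hwK : meshPoint δ (nearestSite δ w) ∈ closedBall z (ρz / 2) ∪ closedBall w (ρw / 2) :=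
    Or.inr (mem_closedBall.2 ((dist_meshPoint_nearestSite_le hδ.1 w).trans
      (hδ.2.le.trans (min_le_right _ _))))
  have hzD : nearestSite δ z ∈ meshDomain D'.carrier δ := hJ.1 _ hzK
  have hwD : nearestSite δ w ∈ meshDomain D'.carrier δ := hJ.1 _ hwK
  have hbD : b δ ∈ meshDomain D'.carrier δ := mem_meshDomain_of_reachable_ne hr.symm (Ne.symm hne)
  have key : ∀ u v : Site 2, u ∈ meshDomain D'.carrier δ → v ∈ meshDomain D'.carrier δ →
      (discreteDomainGraph D'.carrier δ).Reachable u v := by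
    intro u v hu hv
    obtain ⟨hu', hv', hreach⟩ := hJ.2 u hu v hv
    obtain ⟨p⟩ := hreach
    exact reachable_discreteDomainGraph_of_walk p hu
  exact ⟨key _ _ hzD hbD, key _ _ hzD hwD⟩

/-! ### The two-end transfer from anchor locality -/

/-- **Anchor locality ⇒ anchor transfer.** If at each marked prime end `D.pt i` the double ratio
`[⟨σ_xσ_y⟩_{Ω'}/⟨σ_{x'}σ_y⟩_{Ω'}] / [⟨σ_xσ_y⟩_{Ω}/⟨σ_{x'}σ_y⟩_{Ω}]` of two nearby anchors against a far spin
is eventually within any `η` of `1` (hypothesis: anchor locality), then the crux's nested ratio at the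
endpoint approximation `(a_δ, b_δ)` is eventually within `η` of the nested ratio of the bulk two-point
functions at the rounded sites of bulk points `z, w ∈ D'` close to `D.pt 0`, `D.pt 1`: apply locality at
`D.pt 0` (anchors `a_δ`, `[z/δ]`, far spin `b_δ`) and at `D.pt 1` (anchors `b_δ`, `[w/δ]`, far spin
`[z/δ]`), use `T_comm`, the GKS sandwich `T_mono` and positivity `T_pos_of_reachable`, and conclude with
`transfer_algebra`. [folklore] -/
theorem anchorTransfer_of_anchorLocality
    (hL : ∀ (D D' : DobrushinDomain) (i : Fin 2) (ε : ℝ), D'.carrier ⊆ D.carrier → 0 < ε →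
      D'.carrier ∩ ball (D.pt i) ε = D.carrier ∩ ball (D.pt i) ε →
      ∀ c : ℝ, 0 < c → ∀ η : ℝ, 0 < η → ∃ r : ℝ, 0 < r ∧
        ∀ (x x' y : ℝ → Site 2),
          (∀ᶠ δ in 𝓝[>] (0 : ℝ), dist (meshPoint δ (x δ)) (D.pt i) < r) →
          (∀ᶠ δ in 𝓝[>] (0 : ℝ), dist (meshPoint δ (x' δ)) (D.pt i) < r) →
          (∀ᶠ δ in 𝓝[>] (0 : ℝ), c ≤ dist (meshPoint δ (y δ)) (D.pt i)) →
          (∀ᶠ δ in 𝓝[>] (0 : ℝ), (discreteDomainGraph D'.carrier δ).Reachable (x δ) (y δ) ∧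
            (discreteDomainGraph D'.carrier δ).Reachable (x' δ) (y δ)) →
          (∀ᶠ δ in 𝓝[>] (0 : ℝ), meshDomain D'.carrier δ ⊆ meshDomain D.carrier δ) →
          ∀ᶠ δ in 𝓝[>] (0 : ℝ),
            |T D'.carrier δ (x δ) (y δ) / T D'.carrier δ (x' δ) (y δ) /
                (T D.carrier δ (x δ) (y δ) / T D.carrier δ (x' δ) (y δ)) - 1| < η) :
    ∀ (D D' : DobrushinDomain) (a b : ℝ → Site 2), SAW.IsEndpointApprox D a b →
      SAW.IsEndpointApprox D' a b → D'.carrier ⊆ D.carrier →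
      (∃ ε : ℝ, 0 < ε ∧ D'.carrier ∩ ball (D.pt 0) ε = D.carrier ∩ ball (D.pt 0) ε ∧
        D'.carrier ∩ ball (D.pt 1) ε = D.carrier ∩ ball (D.pt 1) ε) →
      ∀ η : ℝ, 0 < η → ∃ r : ℝ, 0 < r ∧ ∀ z w : ℂ, z ∈ D'.carrier → w ∈ D'.carrier →
        dist z (D.pt 0) < r → dist w (D.pt 1) < r →
        ∀ᶠ δ in 𝓝[>] (0 : ℝ),
          |T D'.carrier δ (a δ) (b δ) / T D.carrier δ (a δ) (b δ) -
            T D'.carrier δ (nearestSite δ z) (nearestSite δ w) /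
              T D.carrier δ (nearestSite δ z) (nearestSite δ w)| < η := by
  intro D D' a b hD hD' hsub hε η hη
  obtain ⟨ε, hε0, hb0, hb1⟩ := hε
  have hab : D.pt 0 ≠ D.pt 1 := fun h => absurd (D.pt_injective h) (by decide)
  set L := dist (D.pt 0) (D.pt 1) with hLdef
  have hL0 : 0 < L := dist_pos.2 hab
  set η₁ : ℝ := min 1 (η / 3) with hη₁def
  have hη₁0 : 0 < η₁ := lt_min one_pos (by positivity)
  have hη₁1 : η₁ ≤ 1 := min_le_left _ _
  have hη₁3 : 3 * η₁ ≤ η := by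
    have := min_le_right 1 (η / 3)
    linarith
  obtain ⟨r₁, hr₁, H₁⟩ := hL D D' 0 ε hsub hε0 hb0 (L / 2) (half_pos hL0) η₁ hη₁0
  obtain ⟨r₂, hr₂, H₂⟩ := hL D D' 1 ε hsub hε0 hb1 (L / 2) (half_pos hL0) η₁ hη₁0
  refine ⟨min (min r₁ r₂) (L / 4), lt_min (lt_min hr₁ hr₂) (by positivity), ?_⟩
  intro z w hz hw hzr hwr
  have hzr₁ : dist z (D.pt 0) < r₁ := lt_of_lt_of_le hzr ((min_le_left _ _).trans (min_le_left _ _))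
  have hwr₂ : dist w (D.pt 1) < r₂ := lt_of_lt_of_le hwr ((min_le_left _ _).trans (min_le_right _ _))
  have hzL : dist z (D.pt 0) < L / 4 := lt_of_lt_of_le hzr (min_le_right _ _)
  -- eventual facts along `δ → 0⁺`
  have hnest := eventually_meshDomain_subset hD hD' hsub
  have hbulk := eventually_bulk_reachable hD' hz hw
  have ex_a : ∀ᶠ δ in 𝓝[>] (0 : ℝ), dist (meshPoint δ (a δ)) (D.pt 0) < r₁ :=
    (Metric.tendsto_nhds.1 hD.tendsto_fst) r₁ hr₁
  have ex_z : ∀ᶠ δ in 𝓝[>] (0 : ℝ), dist (meshPoint δ (nearestSite δ z)) (D.pt 0) < r₁ := by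
    filter_upwards [Ioo_mem_nhdsGT (sub_pos.2 hzr₁)] with δ hδ
    calc dist (meshPoint δ (nearestSite δ z)) (D.pt 0)
        ≤ dist (meshPoint δ (nearestSite δ z)) z + dist z (D.pt 0) := dist_triangle _ _ _
      _ ≤ δ + dist z (D.pt 0) := by
          gcongr
          exact dist_meshPoint_nearestSite_le hδ.1 z
      _ < r₁ := by linarith [hδ.2]
  have ex_b : ∀ᶠ δ in 𝓝[>] (0 : ℝ), dist (meshPoint δ (b δ)) (D.pt 1) < r₂ :=
    (Metric.tendsto_nhds.1 hD.tendsto_snd) r₂ hr₂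
  have ex_w : ∀ᶠ δ in 𝓝[>] (0 : ℝ), dist (meshPoint δ (nearestSite δ w)) (D.pt 1) < r₂ := by
    filter_upwards [Ioo_mem_nhdsGT (sub_pos.2 hwr₂)] with δ hδ
    calc dist (meshPoint δ (nearestSite δ w)) (D.pt 1)
        ≤ dist (meshPoint δ (nearestSite δ w)) w + dist w (D.pt 1) := dist_triangle _ _ _
      _ ≤ δ + dist w (D.pt 1) := by
          gcongr
          exact dist_meshPoint_nearestSite_le hδ.1 w
      _ < r₂ := by linarith [hδ.2]
  have far_b : ∀ᶠ δ in 𝓝[>] (0 : ℝ), L / 2 ≤ dist (meshPoint δ (b δ)) (D.pt 0) := by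
    filter_upwards [(Metric.tendsto_nhds.1 hD.tendsto_snd) (L / 2) (half_pos hL0)] with δ hδ
    have h3 := dist_triangle (D.pt 0) (meshPoint δ (b δ)) (D.pt 1)
    rw [dist_comm (D.pt 0) (meshPoint δ (b δ))] at h3
    linarith
  have far_z : ∀ᶠ δ in 𝓝[>] (0 : ℝ), L / 2 ≤ dist (meshPoint δ (nearestSite δ z)) (D.pt 1) := by
    filter_upwards [Ioo_mem_nhdsGT (show (0 : ℝ) < L / 4 by positivity)] with δ hδ
    have h1 : dist (meshPoint δ (nearestSite δ z)) z ≤ δ := dist_meshPoint_nearestSite_le hδ.1 z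
    have h2 := dist_triangle (D.pt 0) z (D.pt 1)
    have h3 := dist_triangle z (meshPoint δ (nearestSite δ z)) (D.pt 1)
    rw [dist_comm z (meshPoint δ (nearestSite δ z))] at h3
    rw [dist_comm (D.pt 0) z] at h2
    linarith [hδ.2]
  have reach₁ : ∀ᶠ δ in 𝓝[>] (0 : ℝ), (discreteDomainGraph D'.carrier δ).Reachable (a δ) (b δ) ∧
      (discreteDomainGraph D'.carrier δ).Reachable (nearestSite δ z) (b δ) := by
    filter_upwards [hD'.reachable, hbulk] with δ h1 h2
    exact ⟨h1, h2.1⟩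
  have reach₂ : ∀ᶠ δ in 𝓝[>] (0 : ℝ),
      (discreteDomainGraph D'.carrier δ).Reachable (b δ) (nearestSite δ z) ∧
      (discreteDomainGraph D'.carrier δ).Reachable (nearestSite δ w) (nearestSite δ z) := by
    filter_upwards [hbulk] with δ h2
    exact ⟨h2.1.symm, h2.2.symm⟩
  have E₁ := H₁ a (fun δ => nearestSite δ z) b ex_a ex_z far_b reach₁ hnest
  have E₂ := H₂ b (fun δ => nearestSite δ w) (fun δ => nearestSite δ z) ex_b ex_w far_z reach₂ hnest
  filter_upwards [E₁, E₂, hbulk, hD'.reachable, hnest, self_mem_nhdsWithin] with δ h₁ h₂ hbk hr' hΛ hδ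
  have hδ0 : (0 : ℝ) < δ := hδ
  have hbdd' : Bornology.IsBounded D'.carrier := D.isBounded.subset hsub
  have hmono : discreteDomainGraph D'.carrier δ ≤ discreteDomainGraph D.carrier δ :=
    discreteDomainGraph_mono hsub hΛ
  have h₁' : |T D'.carrier δ (a δ) (b δ) / T D'.carrier δ (nearestSite δ z) (b δ) /
      (T D.carrier δ (a δ) (b δ) / T D.carrier δ (nearestSite δ z) (b δ)) - 1| < η₁ := h₁
  have h₂' : |T D'.carrier δ (b δ) (nearestSite δ z) / T D'.carrier δ (nearestSite δ w) (nearestSite δ z) /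
      (T D.carrier δ (b δ) (nearestSite δ z) / T D.carrier δ (nearestSite δ w) (nearestSite δ z)) - 1| < η₁ := h₂
  rw [T_comm D'.carrier δ (b δ), T_comm D.carrier δ (b δ), T_comm D'.carrier δ (nearestSite δ w),
    T_comm D.carrier δ (nearestSite δ w)] at h₂'
  -- positivity (GKS I via the high-temperature expansion) and the GKS-II sandwich
  have pab : 0 < T D.carrier δ (a δ) (b δ) := T_pos_of_reachable D.isBounded hδ0 (hr'.mono hmono)
  have pzb' : 0 < T D'.carrier δ (nearestSite δ z) (b δ) := T_pos_of_reachable hbdd' hδ0 hbk.1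
  have pzb : 0 < T D.carrier δ (nearestSite δ z) (b δ) :=
    T_pos_of_reachable D.isBounded hδ0 (hbk.1.mono hmono)
  have pzw' : 0 < T D'.carrier δ (nearestSite δ z) (nearestSite δ w) := T_pos_of_reachable hbdd' hδ0 hbk.2
  have pzw : 0 < T D.carrier δ (nearestSite δ z) (nearestSite δ w) :=
    T_pos_of_reachable D.isBounded hδ0 (hbk.2.mono hmono)
  have hWW : T D'.carrier δ (nearestSite δ z) (nearestSite δ w) ≤
      T D.carrier δ (nearestSite δ z) (nearestSite δ w) := by
    by_cases hzw : nearestSite δ z = nearestSite δ w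
    · rw [hzw, T_self, T_self]
    · obtain ⟨hx, hy⟩ := mem_meshDomainFinset_of_reachable_ne hbdd' hδ0 hbk.2 hzw
      exact T_mono D.isBounded hδ0 hsub hΛ hx hy
  exact transfer_algebra pab pzb' pzb pzw' pzw hWW hη₁1 hη₁3 h₁' h₂'

/-! ### CDH16 Thm 1.1 ⇒ anchor locality (through the landed FK heart) -/

/-- CDH16 Thm 1.1 ⇒ the rough half-annulus RSW for the mesh graph in large-modulus form
(`RoughHalfAnnulusRSWMeshLargeOf AnnPathSepG`): the wave-2 decomposition `roughHalfAnnulusRSWMeshLarge_of_bounds`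
fed with the planar separation lemma, the one-ball-component lemma, and the two CDH16 instances
(`halfAnnulusSideCrossingBound_of`, `halfAnnulusRimCrossingBoundLarge_of'`) over the landed window
presentation, resistance bound and the two discharged §3.3 resistance facts. [folklore] -/
theorem roughHalfAnnulusRSWMeshLarge_of_cdh16
    (hf : Literature.Probability.LatticeModels.fkIsing_topologicalRectangle_crossingBounds) :
    RoughHalfAnnulusRSWMeshLargeOf AnnPathSepG :=
  Summit.CriticalPhenomena.SAWScalingLimit.Theorems.IsingBoundaryRatio.roughHalfAnnulusRSWMeshLarge_of_bounds
    Summit.CriticalPhenomena.SAWScalingLimit.Theorems.IsingBoundaryRatio.annSideCrossSeparation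
    Summit.CriticalPhenomena.SAWScalingLimit.Theorems.IsingBoundaryRatio.stub_chartDiscOneComponent
    (Summit.CriticalPhenomena.SAWScalingLimit.Theorems.IsingBoundaryRatio.halfAnnulusSideCrossingBound_of hf
      Literature.Probability.LatticeModels.discreteEL_ext_sandwich_holds
      Summit.CriticalPhenomena.SAWScalingLimit.Theorems.IsingBoundaryRatio.windowRectPresentation_holds
      Summit.CriticalPhenomena.SAWScalingLimit.Theorems.IsingBoundaryRatio.windowExtResistanceBound_holds)
    (Summit.CriticalPhenomena.SAWScalingLimit.Theorems.IsingBoundaryRatio.halfAnnulusRimCrossingBoundLarge_of' hf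
      Literature.Probability.LatticeModels.discreteEL_ext_sandwich_holds
      Literature.Probability.LatticeModels.discreteEL_ext_selfDual_holds
      Summit.CriticalPhenomena.SAWScalingLimit.Theorems.IsingBoundaryRatio.windowRectPresentation_holds
      Summit.CriticalPhenomena.SAWScalingLimit.Theorems.IsingBoundaryRatio.windowExtResistanceBound_holds
      Summit.CriticalPhenomena.SAWScalingLimit.Theorems.IsingBoundaryRatio.annCrossThroughWindowRect_holds)

/-- CDH16 Thm 1.1 ⇒ the FK heart at `pt 0`: arm-origin forgetting for free critical FK–Ising connection
probabilities at the rough marked prime end (`stub_fkArmOriginForgettingBS` applied to chart-annulus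
separation, the mesh RSW, the radial crossing bound and the path-form RSW). [folklore] -/
theorem fkArmOriginForgettingAt_of_cdh16
    (hf : Literature.Probability.LatticeModels.fkIsing_topologicalRectangle_crossingBounds) :
    ∀ (D : DobrushinDomain), FKArmOriginForgettingAt D.carrier (D.pt 0) :=
  Summit.CriticalPhenomena.SAWScalingLimit.Theorems.IsingBoundaryRatio.stub_fkArmOriginForgettingBS
    Summit.CriticalPhenomena.SAWScalingLimit.Theorems.IsingBoundaryRatio.stub_chartAnnulusSeparation
    (roughHalfAnnulusRSWMeshLarge_of_cdh16 hf)
    Summit.CriticalPhenomena.SAWScalingLimit.Theorems.IsingBoundaryRatio.stub_halfAnnulusRadialCrossingBound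
    (Summit.CriticalPhenomena.SAWScalingLimit.Theorems.IsingBoundaryRatio.roughHalfAnnulusRSWPathLarge_of_pathMeshLarge
      (roughHalfAnnulusRSWMeshLarge_of_cdh16 hf))

/-- CDH16 Thm 1.1 ⇒ the repaired arm-origin forgetting `ArmOriginForgettingAt'` at `pt 0` (in-volume walks):
rewrite the four free Ising two-point functions as FK connection probabilities (Edwards–Sokal,
`stub_freeTwoPoint_eq_fkConn`) in the FK heart. [folklore] -/
theorem armOriginForgettingAt'_of_cdh16
    (hf : Literature.Probability.LatticeModels.fkIsing_topologicalRectangle_crossingBounds) :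
    ∀ (D : DobrushinDomain), ArmOriginForgettingAt' D.carrier (D.pt 0) := by
  intro D ε c η hε hc hη
  obtain ⟨r, hr, hev⟩ := fkArmOriginForgettingAt_of_cdh16 hf D ε c η hε hc hη
  refine ⟨r, hr, ?_⟩
  filter_upwards [hev] with δ hδ
  intro G₁ _ G₂ _ Λ₁ Λ₂ x x' y₁ y₂ hL₁ hL₂ hx₁ hx₂ hx'₁ hx'₂ hy₁ hy₂ hdx hdx' hdy₁ hdy₂ w₁ w₁' w₂ w₂'
  have key := hδ G₁ G₂ Λ₁ Λ₂ x x' y₁ y₂ hL₁ hL₂ hx₁ hx₂ hx'₁ hx'₂ hy₁ hy₂ hdx hdx' hdy₁ hdy₂ w₁ w₁' w₂ w₂'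
  simp only at key
  rw [Summit.CriticalPhenomena.SAWScalingLimit.Theorems.IsingBoundaryRatio.stub_freeTwoPoint_eq_fkConn G₁ Λ₁ x y₁
      hx₁ hy₁,
    Summit.CriticalPhenomena.SAWScalingLimit.Theorems.IsingBoundaryRatio.stub_freeTwoPoint_eq_fkConn G₁ Λ₁ x' y₁
      hx'₁ hy₁,
    Summit.CriticalPhenomena.SAWScalingLimit.Theorems.IsingBoundaryRatio.stub_freeTwoPoint_eq_fkConn G₂ Λ₂ x y₂
      hx₂ hy₂,
    Summit.CriticalPhenomena.SAWScalingLimit.Theorems.IsingBoundaryRatio.stub_freeTwoPoint_eq_fkConn G₂ Λ₂ x' y₂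
      hx'₂ hy₂]
  exact key

/-- `ArmOriginForgetting'` (both marked points of every Dobrushin domain) from the repaired heart at
`pt 0` and the reversal of Dobrushin domains (`Fin 2` cases). [folklore] -/
theorem armOriginForgetting'_of_core
    (hcore : ∀ (D : DobrushinDomain), ArmOriginForgettingAt' D.carrier (D.pt 0))
    (hrev : ∀ (D : DobrushinDomain), ∃ D' : DobrushinDomain, D'.carrier = D.carrier ∧ D'.pt 0 = D.pt 1) :
    ArmOriginForgetting' := by
  intro D i
  fin_cases i
  · exact hcore D
  · obtain ⟨D', hc, hp⟩ := hrev D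
    have h := hcore D'
    rw [hc, hp] at h
    simpa using h

/-- **CDH16 Thm 1.1 ⇒ anchor locality** at a marked prime end: the double ratio of two nearby anchors'
correlations with a far spin, `Ω'` over `Ω`, is eventually within `η` of `1` — the repaired local-agreement
transfer `stub_localAgreementTransfer'` applied to `ArmOriginForgetting'` (`armOriginForgetting'_of_core`
with `armOriginForgettingAt'_of_cdh16` and `stub_reverseDobrushin`). [folklore] -/
theorem anchorLocality_of_cdh16
    (hf : Literature.Probability.LatticeModels.fkIsing_topologicalRectangle_crossingBounds) :
    ∀ (D D' : DobrushinDomain) (i : Fin 2) (ε : ℝ), D'.carrier ⊆ D.carrier → 0 < ε →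
      D'.carrier ∩ ball (D.pt i) ε = D.carrier ∩ ball (D.pt i) ε →
      ∀ c : ℝ, 0 < c → ∀ η : ℝ, 0 < η → ∃ r : ℝ, 0 < r ∧
        ∀ (x x' y : ℝ → Site 2),
          (∀ᶠ δ in 𝓝[>] (0 : ℝ), dist (meshPoint δ (x δ)) (D.pt i) < r) →
          (∀ᶠ δ in 𝓝[>] (0 : ℝ), dist (meshPoint δ (x' δ)) (D.pt i) < r) →
          (∀ᶠ δ in 𝓝[>] (0 : ℝ), c ≤ dist (meshPoint δ (y δ)) (D.pt i)) →
          (∀ᶠ δ in 𝓝[>] (0 : ℝ), (discreteDomainGraph D'.carrier δ).Reachable (x δ) (y δ) ∧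
            (discreteDomainGraph D'.carrier δ).Reachable (x' δ) (y δ)) →
          (∀ᶠ δ in 𝓝[>] (0 : ℝ), meshDomain D'.carrier δ ⊆ meshDomain D.carrier δ) →
          ∀ᶠ δ in 𝓝[>] (0 : ℝ),
            |T D'.carrier δ (x δ) (y δ) / T D'.carrier δ (x' δ) (y δ) /
                (T D.carrier δ (x δ) (y δ) / T D.carrier δ (x' δ) (y δ)) - 1| < η :=
  Summit.CriticalPhenomena.SAWScalingLimit.Theorems.IsingBoundaryRatio.stub_localAgreementTransfer'
    (armOriginForgetting'_of_core (armOriginForgettingAt'_of_cdh16 hf)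
      Summit.CriticalPhenomena.SAWScalingLimit.Theorems.IsingBoundaryRatio.stub_reverseDobrushin)

/-! ### The composition -/

/-- **The crux `IsingBoundaryRatio`, conditionally on the two printed named facts** CDH16 Thm 1.1
(`fkIsing_topologicalRectangle_crossingBounds`) and CHI15 Thm 1.1 free (`chi_twoPoint_free_jordan`):
anchor locality (`anchorLocality_of_cdh16`) ⇒ anchor transfer (`anchorTransfer_of_anchorLocality`) ⇒ the
crux, by the landed equivalence `isingBoundaryRatio_iff_anchorTransfer` (bulk free ratio from CHI's
theorem, boundary fusion, the `3η` assembly and the `T`-normal form of the crux). [folklore] -/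
theorem IsingBoundaryRatio_of
    (hf : Literature.Probability.LatticeModels.fkIsing_topologicalRectangle_crossingBounds)
    (hX : Literature.Probability.LatticeModels.chi_twoPoint_free_jordan) :
    Summit.CriticalPhenomena.SAWScalingLimit.Theses.SAWLoopFugacityFlow.IsingBoundaryRatio :=
  (Summit.CriticalPhenomena.SAWScalingLimit.Theorems.IsingBoundaryRatio.isingBoundaryRatio_iff_anchorTransfer
      hX).2 (anchorTransfer_of_anchorLocality (anchorLocality_of_cdh16 hf))

end Summit.CriticalPhenomena.SAWScalingLimit.Theorems.IsingBoundaryRatio.CruxGlue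

end
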